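import Literature.NumberTheory.EllipticCurves.ShuZhai2021.GeneralizedBirchLemma
import HarnessLib

/-!
# Shu–Zhai 2021 (Crelle 775), §5.2 Table — the rows `20a1`, `52a1`, `84a1`, `84b1` AS PRINTED: optimal curves with
# `f([0]) ∉ 2E(ℚ)` (statement-only named facts; the per-curve inputs of Thm 1.2 / Thm 1.4 at the four rows of the table that
# are ADDITIVE at `2` and non-CM)

HONEST FRAMING (cell `bsd-2adic`, seat `bsd-2adic-k4-w2` GEN 7; K4 crux `AdditiveRankZeroAtTwo` 19098, children C3″ 22617 /
C2″ 22616; 2026-08-29): PUBLISHED per-curve assertions vendored as named `Prop`s (nothing asserted, nothing discharged; D-0014),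
with a locator into the held text; companion of `ShuZhai2021.table52_row36a1` (cell `bsd-print-cf2`), same shape verbatim. They
are the only non-kernel, non-theorem inputs of the cell's Shu–Zhai roads at these bases
(`Summits/BirchSwinnertonDyer/BirchSwinnertonDyer/Theorems/ByReductionTypeAtTwoAdditivePotGoodPrintShuZhai{20a1,52a1,84a1,84b1}*.lean`,
where the optimality datum and `f([0]) ∉ 2E(ℚ)` were DISPLAYED hypotheses `hopt`, `hcusp`): the optimal modular parametrisation
`f : X₀(N) → E` and the position of the torsion point `f([0])` are values of modular symbols, which the kernel cannot evaluate. The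
other columns of the rows (Condition (Tor) `#E(ℚ)[2] = 2 = #E′(ℚ)[2]`, the fields `ℚ(E[2])`, `ℚ(E′[2])`, the admissible primes and
the Heegner primes `p`) are decided IN THE KERNEL by the consumers. Nothing booked here; BSD is not proved by any of this.

Source. J. Shu, S. Zhai, *Generalized Birch lemma and the 2-part of the Birch and Swinnerton-Dyer conjecture for certain elliptic
curves*, J. reine angew. Math. **775** (2021), 117–143 = arXiv:2102.11808 [ShuZhai2021]. Text read: the held LaTeX-derived text
`paper:arxiv-2102.11808`, §5.2 = chunk p0014 L67–L95, §1 = chunk p0003 L3–L12.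

## The printed statement (verbatim)

* §1 (p0003 L3): "we let `f : X₀(N) → E` be an optimal modular parametrization sending the cusp at infinity `[∞]` to the zero
  element of `E`. We write `[0]` for the cusp of `X₀(N)` arising from the zero point in `ℙ¹(ℚ)` … By the theorem of Manin–Drinfeld,
  `f([0])` is a torsion point in `E(ℚ)`." (p0003 L8–L10): "We assume throughout this paper that the group `E[2](ℚ)` … is cyclic of
  order 2, and we define `E′ = E/E[2](ℚ)` … (Tor) `E[2](ℚ) = E′[2](ℚ) = ℤ/2ℤ`."
* §5.2 (p0014 L67–L69): "The theorem can be applied on the family of quadratic twists of many elliptic curves `E/ℚ`, we include a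
  table here when the conductor of `E` is less than `100`." Table caption: "`E/ℚ` satisfying `f([0]) ∉ 2E(ℚ)` and Condition (Tor)
  with conductor `N < 100`." Columns: `E`, `ℚ(E[2])`, `ℚ(E′[2])`, admissible primes `q`, `p`. Rows (L79, L85, L91, L92):
  "`20a1 | ℚ(√−1) | ℚ(√5) | 3,7,23,43,47,67,83,103,… | 31,71,79,151,191,199,…`";
  "`52a1 | ℚ(√−1) | ℚ(√13) | 7,11,19,31,47,59,67,71,… | 23,79,103,127,191,199,…`";
  "`84a1 | ℚ(√−3) | ℚ(√7) | 5,11,17,23,41,71,89,101,… | 47,59,83,131,167,227,…`";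
  "`84b1 | ℚ(√−3) | ℚ(√7) | 5,11,17,23,41,71,89,101,… | 47,59,83,131,167,227,…`".

## Transcription (tree dictionary of `ShuZhai2021/GeneralizedBirchLemma.lean`)

"`E` optimal with parametrisation `f`" = a datum `Dt : ModularParametrizationData W (N(W))` of the globally minimal model `W` of the
row's curve at the conductor level, satisfying the lattice equality `IsOptimalDatum W Dt`; "`f([0]) ∉ 2E(ℚ)`" = `CuspZeroNotInTwice W Dt`
— exactly the two displayed binders `hopt`, `hcusp` of the consumers' `thm12Setting_*`. Models (Cremona 1992 Table 1, the
`Γ₀(N)`-optimal curves of their classes): `20a1 = [0, 1, 0, 4, 4]` (held scan p. 99), `52a1 = [0, 0, 0, 1, −10]` (p. 108), `84a1 = [0, 1, 0, 7, 0]`,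
`84b1 = [0, −1, 0, −1, −2]` (p. 130: «84 A1(C)», «84 B1(A)»; `N = 84 = 2²·3·7`, `r = 0`, `#T = 6` resp. `2`, Kodaira `IV, I₃, I₂` resp.
`IV, I₁, I₂`). The `NeZero` witness for the level is packed in the statement (as in `table52_row36a1`). Nothing weaker or stronger is
transcribed; no `_holds` expected (modular-symbol computations for `Γ₀(N)`). Status: PUB (refereed); per-curve computational TABLE
entries, flag word for the referee: TABLE.

## References
* [ShuZhai2021] §1 (chunk p0003 L3–L12), §5.2 Table rows 20a1, 52a1, 84a1, 84b1 (chunk p0014 L67–L92).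
* [CremonaAlgorithms1997] Table 1 (curves 20A1, 52A1, 84A1, 84B1; held scan pp. 99, 108, 130).
-/

noncomputable section

open WeierstrassCurve Literature.NumberTheory.EllipticCurves
  Literature.NumberTheory.EllipticCurves.ModularForms

namespace Literature.NumberTheory.EllipticCurves.ShuZhai2021

/-- **Shu–Zhai 2021, §5.2 Table, row `20a1`** (verbatim in the module docstring): the optimal curve `20a1` — on its globally minimal
model `[0,1,0,4,4]` — admits an optimal modular parametrisation datum `Dt` at level `N(E)` (`IsOptimalDatum`) with `f([0]) ∉ 2E(ℚ)`
(`CuspZeroNotInTwice`). Statement only; TABLE entry in a refereed paper; no `_holds` expected.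
[cite: ShuZhai2021, §5.2 Table (row 20a1) and §1 (arXiv:2102.11808 chunk p0014 L79, chunk p0003 L3)] -/
def table52_row20a1 : Prop :=
  ∃ (_ : NeZero ((⟨0, 1, 0, 4, 4⟩ : WeierstrassCurve ℚ).conductorNorm ℤ))
    (Dt : ModularParametrizationData (⟨0, 1, 0, 4, 4⟩ : WeierstrassCurve ℚ) ((⟨0, 1, 0, 4, 4⟩ : WeierstrassCurve ℚ).conductorNorm ℤ)),
    IsOptimalDatum (⟨0, 1, 0, 4, 4⟩ : WeierstrassCurve ℚ) Dt ∧ CuspZeroNotInTwice (⟨0, 1, 0, 4, 4⟩ : WeierstrassCurve ℚ) Dt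

/-- **Shu–Zhai 2021, §5.2 Table, row `52a1`**: the optimal curve `52a1` — on its globally minimal model `[0,0,0,1,−10]` — admits an
optimal modular parametrisation datum `Dt` at level `N(E)` with `f([0]) ∉ 2E(ℚ)`. Statement only; TABLE entry; no `_holds` expected.
[cite: ShuZhai2021, §5.2 Table (row 52a1) and §1 (arXiv:2102.11808 chunk p0014 L85, chunk p0003 L3)] -/
def table52_row52a1 : Prop :=
  ∃ (_ : NeZero ((⟨0, 0, 0, 1, -10⟩ : WeierstrassCurve ℚ).conductorNorm ℤ))
    (Dt : ModularParametrizationData (⟨0, 0, 0, 1, -10⟩ : WeierstrassCurve ℚ) ((⟨0, 0, 0, 1, -10⟩ : WeierstrassCurve ℚ).conductorNorm ℤ)),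
    IsOptimalDatum (⟨0, 0, 0, 1, -10⟩ : WeierstrassCurve ℚ) Dt ∧ CuspZeroNotInTwice (⟨0, 0, 0, 1, -10⟩ : WeierstrassCurve ℚ) Dt

/-- **Shu–Zhai 2021, §5.2 Table, row `84a1`**: the optimal curve `84a1` — on its globally minimal model `[0,1,0,7,0]` — admits an optimal
modular parametrisation datum `Dt` at level `N(E)` with `f([0]) ∉ 2E(ℚ)`. Statement only; TABLE entry; no `_holds` expected.
[cite: ShuZhai2021, §5.2 Table (row 84a1) and §1 (arXiv:2102.11808 chunk p0014 L91, chunk p0003 L3)] -/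
def table52_row84a1 : Prop :=
  ∃ (_ : NeZero ((⟨0, 1, 0, 7, 0⟩ : WeierstrassCurve ℚ).conductorNorm ℤ))
    (Dt : ModularParametrizationData (⟨0, 1, 0, 7, 0⟩ : WeierstrassCurve ℚ) ((⟨0, 1, 0, 7, 0⟩ : WeierstrassCurve ℚ).conductorNorm ℤ)),
    IsOptimalDatum (⟨0, 1, 0, 7, 0⟩ : WeierstrassCurve ℚ) Dt ∧ CuspZeroNotInTwice (⟨0, 1, 0, 7, 0⟩ : WeierstrassCurve ℚ) Dt

/-- **Shu–Zhai 2021, §5.2 Table, row `84b1`**: the optimal curve `84b1` — on its globally minimal model `[0,−1,0,−1,−2]` — admits an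
optimal modular parametrisation datum `Dt` at level `N(E)` with `f([0]) ∉ 2E(ℚ)`. Statement only; TABLE entry; no `_holds` expected.
[cite: ShuZhai2021, §5.2 Table (row 84b1) and §1 (arXiv:2102.11808 chunk p0014 L92, chunk p0003 L3)] -/
def table52_row84b1 : Prop :=
  ∃ (_ : NeZero ((⟨0, -1, 0, -1, -2⟩ : WeierstrassCurve ℚ).conductorNorm ℤ))
    (Dt : ModularParametrizationData (⟨0, -1, 0, -1, -2⟩ : WeierstrassCurve ℚ) ((⟨0, -1, 0, -1, -2⟩ : WeierstrassCurve ℚ).conductorNorm ℤ)),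
    IsOptimalDatum (⟨0, -1, 0, -1, -2⟩ : WeierstrassCurve ℚ) Dt ∧ CuspZeroNotInTwice (⟨0, -1, 0, -1, -2⟩ : WeierstrassCurve ℚ) Dt

/-- **Shu–Zhai 2021, §5.2 Table, row `80b1`** (table line `80b1 | ℚ(√−1) | ℚ(√5) | 3,7,23,43,47,67,83,103,… | 31,71,79,151,191,199,…`,
arXiv:2102.11808 chunk p0014 L90): the optimal curve `80b1` — on its globally minimal model `[0,−1,0,4,−4]` (Cremona 1992 Table 1
«80 B1»: `r = 0`, `#T = 2`, Kodaira `I₀*, I₂`, held scan pp. 128–129; `y² = x³ − x² + 4x − 4 = (x − 1)(x² + 4)`, the `−1`-twist of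
`20a1`) — admits an optimal modular parametrisation datum `Dt` at level `N(E)` with `f([0]) ∉ 2E(ℚ)`. Statement only; TABLE entry;
no `_holds` expected. (Appended 2026-08-29 by the same seat; the four rows above are unchanged.)
[cite: ShuZhai2021, §5.2 Table (row 80b1) and §1 (arXiv:2102.11808 chunk p0014 L90, chunk p0003 L3)] -/
def table52_row80b1 : Prop :=
  ∃ (_ : NeZero ((⟨0, -1, 0, 4, -4⟩ : WeierstrassCurve ℚ).conductorNorm ℤ))
    (Dt : ModularParametrizationData (⟨0, -1, 0, 4, -4⟩ : WeierstrassCurve ℚ) ((⟨0, -1, 0, 4, -4⟩ : WeierstrassCurve ℚ).conductorNorm ℤ)),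
    IsOptimalDatum (⟨0, -1, 0, 4, -4⟩ : WeierstrassCurve ℚ) Dt ∧ CuspZeroNotInTwice (⟨0, -1, 0, 4, -4⟩ : WeierstrassCurve ℚ) Dt

end Literature.NumberTheory.EllipticCurves.ShuZhai2021

end
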